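import Summits.FinalStateConjecture.FinalStateConjecture.Theorems.EIHFluxBalanceInertialRecessionStubQuasiStationarityBound

/-!
# Route EIHFluxBalance — `InertialRecession`, line `sublinear-is-free-clean-window-charges`,
# stub `stub_weightedRates`: Lipschitz dependence of the Kerr–Schild form on the spin

Helper file of the worker on `stub_weightedRates` (crux `stmt-FinalStateConjecture-10166`).
The registered RATES hypothesis of the quasi-stationarity reduction
(`…StubQuasiStationarityReduction.stub_quasiStationarity_of_weightedRates`) asks, for a spinning
hole, for the weighted rate `t^{3/4}‖(Λe₃)˙‖ → 0` of the painted spin AXIS. That clause is only an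
artefact of bounding the body rate modulo the one-dimensional spin stabiliser by the crude kernel
`M/d`: tilting the axis of `g_{M,a}` changes only `g_{M,a} − g_{M,0} = O(M|a|/d²)` (the
Schwarzschild form is isotropic). This file supplies the analytic input of that refinement:

* `kerrSpin_lipschitz_unit` — on the unit shell `{y⁰ = 0, ‖y̲‖ = 1}` and for `|a'| ≤ 1/2`,
  `‖g_{1,a'}(y) − g_{1,0}(y)‖ ≤ L₁|a'|` and `‖(Dg_{1,a'}(y) − Dg_{1,0}(y))u‖ ≤ L₂|a'|‖u‖`
  (mean value theorem in `a'` with the jointly smooth family `(a', y) ↦ g_{1,a'}(y) − η` of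
  `Kerr.contDiffAt_ksPert₂`, bounds of its first two joint derivatives on a compact set);
* `kerrSpin_exists_lipschitz_bounds` — by scaling (`Kerr.ksPert_smul`) and stationarity:
  `‖g_{M,a}(x) − g_{M,0}(x)‖ ≤ |M| Bₐ |a| / ‖x̲‖²` and
  `‖(Dg_{M,a}(x) − Dg_{M,0}(x))u‖ ≤ |M| Bₐ |a| ‖u‖ / ‖x̲‖³` for `‖x̲‖ ≥ max 1 (2|a|)`.
-/

set_option linter.dupNamespace false

noncomputable section

namespace Summit.FinalStateConjecture.FinalStateConjecture.Theorems.SublinearIsFree.WeightedRates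

open scoped BigOperators Topology ContDiff
open Filter Set Function Literature.Geometry.Lorentzian
open Summit.FinalStateConjecture.FinalStateConjecture.Theorems

/-! ### The joint family on the unit shell -/

/-- The compact parameter set `[−1/2, 1/2] × {y⁰ = 0, ‖y̲‖ = 1}` lies in the open set `{r > 0}`
where the joint Kerr–Schild family `(a', y) ↦ g_{1,a'}(y) − η` is smooth, and is compact.
[cite: KerrSchild1965, §3] -/
theorem kerrSpin_unitShell_compact_subset :
    IsCompact (Set.Icc (-(1 / 2 : ℝ)) (1 / 2) ×ˢ {y : E4 | y 0 = 0 ∧ E4.spatialNorm y = 1}) ∧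
      Set.Icc (-(1 / 2 : ℝ)) (1 / 2) ×ˢ {y : E4 | y 0 = 0 ∧ E4.spatialNorm y = 1} ⊆
        {p : ℝ × E4 | 0 < Kerr.radius p.1 p.2} := by
  constructor
  · refine isCompact_Icc.prod ?_
    have hsn : Continuous E4.spatialNorm := continuous_norm.comp E4.spatial.continuous
    have hclosed : IsClosed {y : E4 | y 0 = 0 ∧ E4.spatialNorm y = 1} :=
      (isClosed_eq (PiLp.continuous_apply 2 _ 0) continuous_const).inter
        (isClosed_eq hsn continuous_const)
    refine Metric.isCompact_of_isClosed_isBounded hclosed ?_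
    refine (Metric.isBounded_closedBall (x := (0 : E4)) (r := 1)).subset ?_
    intro y hy
    rw [Metric.mem_closedBall, dist_zero_right]
    have hsq : ‖y‖ ^ 2 = 1 := by
      have h' := E4.spatialNorm_sq y
      rw [hy.2] at h'
      rw [EuclideanSpace.real_norm_sq_eq, Fin.sum_univ_four, hy.1]
      nlinarith [h']
    nlinarith [norm_nonneg y]
  · rintro ⟨a', y⟩ ⟨ha', hy⟩
    change 0 < Kerr.radius a' y
    apply Kerr.radius_pos_of_abs_lt
    rw [hy.2, abs_lt]
    constructor <;> linarith [ha'.1, ha'.2]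

/-- Norm of a horizontal vector `(a', 0)` of `ℝ × E4`. [folklore] -/
theorem prodE4_norm_inl (a' : ℝ) : ‖((a', (0 : E4)) : ℝ × E4)‖ = |a'| := by
  simp [Prod.norm_def]

/-- Norm of a vertical vector `(0, u)` of `ℝ × E4`. [folklore] -/
theorem prodE4_norm_inr (u : E4) : ‖(((0 : ℝ), u) : ℝ × E4)‖ = ‖u‖ := by
  simp [Prod.norm_def]

-- the algebraic and the operator-norm instance paths on `E4 →L[ℝ] E4 →L[ℝ] ℝ` unify slowly
set_option synthInstance.maxHeartbeats 200000 in
set_option maxHeartbeats 800000 in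
/-- **Lipschitz dependence on the spin on the unit shell.** There are `L₁, L₂ ≥ 0` such that for
`|a'| ≤ 1/2` and `y` with `y⁰ = 0`, `‖y̲‖ = 1`:
`‖(g_{1,a'}(y) − η) − (g_{1,0}(y) − η)‖ ≤ L₁|a'|` and, for every `u`,
`‖D(g_{1,a'} − η)(y)u − D(g_{1,0} − η)(y)u‖ ≤ L₂|a'|‖u‖`. Proof: mean value theorem along
`s ↦ (s a', y)` for the jointly smooth family of `Kerr.contDiffAt_ksPert₂` and for its first
`y`-derivative, with `L₁, L₂` bounds of the first two joint derivatives on the compact set of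
`kerrSpin_unitShell_compact_subset`. [cite: KerrSchild1965, §3] -/
theorem kerrSpin_lipschitz_unit :
    ∃ L₁ L₂ : ℝ, 0 ≤ L₁ ∧ 0 ≤ L₂ ∧ ∀ a' : ℝ, |a'| ≤ 1 / 2 → ∀ y : E4, y 0 = 0 →
      E4.spatialNorm y = 1 →
      ‖(Kerr.bilin 1 a' y - Minkowski.bilin) - (Kerr.bilin 1 0 y - Minkowski.bilin)‖ ≤ L₁ * |a'| ∧
      ∀ u : E4, ‖fderiv ℝ (fun z ↦ Kerr.bilin 1 a' z - Minkowski.bilin) y u -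
          fderiv ℝ (fun z ↦ Kerr.bilin 1 0 z - Minkowski.bilin) y u‖ ≤ L₂ * |a'| * ‖u‖ := by
  set Fj : ℝ × E4 → E4 →L[ℝ] E4 →L[ℝ] ℝ := fun q ↦ Kerr.bilin 1 q.1 q.2 - Minkowski.bilin with hFj
  set O : Set (ℝ × E4) := {p | 0 < Kerr.radius p.1 p.2} with hO
  have hOo : IsOpen O := by
    refine isOpen_lt continuous_const ?_
    unfold Kerr.radius E4.spatialNorm
    fun_prop
  have hcd : ContDiffOn ℝ ∞ Fj O := fun p hp ↦ (Kerr.contDiffAt_ksPert₂ hp).contDiffWithinAt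
  set P := ftaylorSeriesWithin ℝ Fj O with hP
  have hT : HasFTaylorSeriesUpToOn ∞ Fj P O := hcd.ftaylorSeriesWithin hOo.uniqueDiffOn
  obtain ⟨hKc, hKO⟩ := kerrSpin_unitShell_compact_subset
  set K : Set (ℝ × E4) :=
    Set.Icc (-(1 / 2 : ℝ)) (1 / 2) ×ˢ {y : E4 | y 0 = 0 ∧ E4.spatialNorm y = 1} with hK
  -- bounds of the first two joint derivatives on `K`
  have hcont : ∀ m : ℕ, ContinuousOn (fun q ↦ P q m) K := fun m ↦
    (hT.cont m (by exact_mod_cast le_top)).mono hKO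
  obtain ⟨C₁, hC₁⟩ := hKc.exists_bound_of_continuousOn (hcont 1)
  obtain ⟨C₂, hC₂⟩ := hKc.exists_bound_of_continuousOn (hcont 2)
  refine ⟨max C₁ 0, max C₂ 0, le_max_right _ _, le_max_right _ _, fun a' ha' y hy0 hy1 ↦ ?_⟩
  -- the segment `s ↦ (s a', y)`, `s ∈ [0, 1]`, stays in `K`
  have hseg : ∀ s ∈ Set.Icc (0 : ℝ) 1, ((s * a', y) : ℝ × E4) ∈ K := fun s hs ↦ by
    refine ⟨⟨?_, ?_⟩, hy0, hy1⟩
    · have : |s * a'| ≤ 1 / 2 := by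
        rw [abs_mul, abs_of_nonneg hs.1]
        nlinarith [abs_nonneg a', hs.2]
      linarith [(abs_le.mp this).1]
    · have : |s * a'| ≤ 1 / 2 := by
        rw [abs_mul, abs_of_nonneg hs.1]
        nlinarith [abs_nonneg a', hs.2]
      exact (abs_le.mp this).2
  have hσ : ∀ s : ℝ, HasDerivAt (fun s : ℝ ↦ ((s * a', y) : ℝ × E4)) (a', 0) s := fun s ↦ by
    have h1 : HasDerivAt (fun s : ℝ ↦ s * a') a' s := by
      simpa using (hasDerivAt_id s).mul_const a'
    exact h1.prodMk (hasDerivAt_const s y)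
  -- differentiability of `Fj` and of its first Taylor coefficient on `O`
  have hFd : ∀ q ∈ O, HasFDerivAt Fj (fderiv ℝ Fj q) q := fun q hq ↦
    ((Kerr.contDiffAt_ksPert₂ hq (n := 1)).differentiableAt one_ne_zero).hasFDerivAt
  have hP1 : ∀ q ∈ O, ∀ v, P q 1 ![v] = fderiv ℝ Fj q v := fun q hq v ↦ by
    rw [hP]
    change iteratedFDerivWithin ℝ 1 Fj O q ![v] = fderiv ℝ Fj q v
    rw [iteratedFDerivWithin_one_apply (hOo.uniqueDiffOn q hq), fderivWithin_of_isOpen hOo hq]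
    rfl
  have hPd : ∀ q ∈ O, HasFDerivAt (fun x ↦ P x 1) (P q 2).curryLeft q := fun q hq ↦
    (hT.fderivWithin 1 (by exact_mod_cast ENat.coe_lt_top 1) q hq).hasFDerivAt (hOo.mem_nhds hq)
  constructor
  · -- values: mean value theorem for `s ↦ Fj (s a', y)`
    have hderiv : ∀ s ∈ Set.Icc (0 : ℝ) 1,
        HasDerivWithinAt (fun s ↦ Fj (s * a', y)) (fderiv ℝ Fj (s * a', y) (a', 0))
          (Set.Icc 0 1) s := fun s hs ↦ by
      have h := HasFDerivAt.comp_hasDerivAt (l := Fj) (f := fun s : ℝ ↦ ((s * a', y) : ℝ × E4))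
        s (hFd _ (hKO (hseg s hs))) (hσ s)
      exact h.hasDerivWithinAt
    have hbound : ∀ s ∈ Set.Ico (0 : ℝ) 1, ‖fderiv ℝ Fj (s * a', y) (a', 0)‖ ≤ max C₁ 0 * |a'| :=
      fun s hs ↦ by
      have hmem := hseg s (Set.Ico_subset_Icc_self hs)
      rw [← hP1 _ (hKO hmem)]
      refine ((P (s * a', y) 1).le_opNorm _).trans ?_
      rw [Fin.prod_univ_one, Matrix.cons_val_zero, prodE4_norm_inl]
      exact mul_le_mul_of_nonneg_right ((hC₁ _ hmem).trans (le_max_left _ _)) (abs_nonneg _)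
    have key := norm_image_sub_le_of_norm_deriv_le_segment_01' (E := E4 →L[ℝ] E4 →L[ℝ] ℝ)
      hderiv hbound
    simp only [one_mul, zero_mul] at key
    simpa [hFj] using key
  · intro u
    -- first derivatives: mean value theorem for `s ↦ P (s a', y) 1 ![(0, u)]`
    have hderiv : ∀ s ∈ Set.Icc (0 : ℝ) 1,
        HasDerivWithinAt (fun s ↦ P (s * a', y) 1 ![((0 : ℝ), u)])
          (((P (s * a', y) 2).curryLeft (a', 0)) ![((0 : ℝ), u)]) (Set.Icc 0 1) s := fun s hs ↦ by
      have h1 := (hPd _ (hKO (hseg s hs))).continuousMultilinear_apply_const ![((0 : ℝ), u)]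
      have h2 := HasFDerivAt.comp_hasDerivAt (l := fun x ↦ P x 1 ![((0 : ℝ), u)])
        (f := fun s : ℝ ↦ ((s * a', y) : ℝ × E4)) s h1 (hσ s)
      rw [ContinuousLinearMap.flipMultilinear_apply_apply] at h2
      exact h2.hasDerivWithinAt
    have hbound : ∀ s ∈ Set.Ico (0 : ℝ) 1,
        ‖((P (s * a', y) 2).curryLeft (a', 0)) ![((0 : ℝ), u)]‖ ≤ max C₂ 0 * |a'| * ‖u‖ :=
      fun s hs ↦ by
      have hmem := hseg s (Set.Ico_subset_Icc_self hs)
      rw [ContinuousMultilinearMap.curryLeft_apply]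
      have hle := (P (s * a', y) 2).le_opNorm (Fin.cons (a', 0) ![((0 : ℝ), u)])
      have hprod : (∏ i : Fin 2, ‖(Fin.cons (a', 0) ![((0 : ℝ), u)] : Fin 2 → ℝ × E4) i‖) =
          |a'| * ‖u‖ := by
        rw [Fin.prod_univ_two, Fin.cons_zero, Fin.cons_one, Matrix.cons_val_zero, prodE4_norm_inl,
          prodE4_norm_inr]
      rw [hprod] at hle
      have hC : ‖P (s * a', y) 2‖ ≤ max C₂ 0 := (hC₂ _ hmem).trans (le_max_left _ _)
      have hau : 0 ≤ |a'| * ‖u‖ := by positivity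
      calc ‖P (s * a', y) 2 (Fin.cons (a', 0) ![((0 : ℝ), u)])‖
          ≤ ‖P (s * a', y) 2‖ * (|a'| * ‖u‖) := hle
        _ ≤ max C₂ 0 * (|a'| * ‖u‖) := mul_le_mul_of_nonneg_right hC hau
        _ = max C₂ 0 * |a'| * ‖u‖ := by ring
    have key := norm_image_sub_le_of_norm_deriv_le_segment_01' (E := E4 →L[ℝ] E4 →L[ℝ] ℝ)
      hderiv hbound
    -- identify the endpoints with the partial derivatives
    have hend : ∀ b : ℝ, ((b, y) : ℝ × E4) ∈ O →
        P (b, y) 1 ![((0 : ℝ), u)] = fderiv ℝ (fun z ↦ Kerr.bilin 1 b z - Minkowski.bilin) y u := by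
      intro b hb
      have hc := HasFDerivAt.comp (g := Fj) (f := fun z : E4 ↦ ((b, z) : ℝ × E4)) y (hFd _ hb)
        (hasFDerivAt_prodMk_right (𝕜 := ℝ) b y)
      change P (b, y) 1 ![((0 : ℝ), u)] = fderiv ℝ (Fj ∘ fun z : E4 ↦ ((b, z) : ℝ × E4)) y u
      rw [hc.fderiv, hP1 _ hb]
      rfl
    have h1mem : ((a', y) : ℝ × E4) ∈ O := by
      have h := hKO (hseg 1 ⟨zero_le_one, le_rfl⟩)
      rwa [one_mul] at h
    have h0mem : (((0 : ℝ), y) : ℝ × E4) ∈ O := by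
      have h := hKO (hseg 0 ⟨le_rfl, zero_le_one⟩)
      rwa [zero_mul] at h
    have hk1 : P (1 * a', y) 1 ![((0 : ℝ), u)] =
        fderiv ℝ (fun z ↦ Kerr.bilin 1 a' z - Minkowski.bilin) y u := by
      have h := hend _ h1mem
      simpa only [one_mul] using h
    have hk0 : P (0 * a', y) 1 ![((0 : ℝ), u)] =
        fderiv ℝ (fun z ↦ Kerr.bilin 1 0 z - Minkowski.bilin) y u := by
      have h := hend _ h0mem
      simpa only [zero_mul] using h
    rw [hk1, hk0] at key
    exact key

-- the algebraic and the operator-norm instance paths on `E4 →L[ℝ] E4 →L[ℝ] ℝ` unify slowly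
set_option synthInstance.maxHeartbeats 200000 in
/-- `‖c T‖ ≤ |c| B` for a bilinear form `T` with `‖T‖ ≤ B` (scalar bookkeeping: Lean does not find
`NormSMulClass` on the space of bilinear forms, so the bound is proved entrywise). [folklore] -/
theorem bilin_norm_smul_le (c : ℝ) (T : E4 →L[ℝ] E4 →L[ℝ] ℝ) {B : ℝ} (hB : ‖T‖ ≤ B) :
    ‖c • T‖ ≤ |c| * B := by
  have hB0 : 0 ≤ B := (norm_nonneg T).trans hB
  refine ContinuousLinearMap.opNorm_le_bound₂ _ (mul_nonneg (abs_nonneg c) hB0) fun v w ↦ ?_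
  have e : (c • T) v w = c * T v w := rfl
  have h := T.le_opNorm₂ v w
  rw [Real.norm_eq_abs] at h
  rw [e, Real.norm_eq_abs, abs_mul]
  have hv := norm_nonneg v
  have hw := norm_nonneg w
  calc |c| * |T v w| ≤ |c| * (‖T‖ * ‖v‖ * ‖w‖) := mul_le_mul_of_nonneg_left h (abs_nonneg c)
    _ ≤ |c| * (B * ‖v‖ * ‖w‖) := by gcongr
    _ = |c| * B * ‖v‖ * ‖w‖ := by ring

/-! ### Scaling to general mass, spin and distance -/

-- the algebraic and the operator-norm instance paths on `E4 →L[ℝ] E4 →L[ℝ] ℝ` unify slowly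
set_option synthInstance.maxHeartbeats 200000 in
set_option maxHeartbeats 800000 in
/-- **Lipschitz dependence of the Kerr–Schild form and of its gradient on the spin, with the
sharp decay.** There is `Bₐ ≥ 0` such that for all `M, a` and all `x` with
`‖x̲‖ ≥ max 1 (2|a|)`: `‖(g_{M,a}(x) − η) − (g_{M,0}(x) − η)‖ ≤ |M| Bₐ |a| / ‖x̲‖²` and, for every
`u`, `‖D(g_{M,a} − η)(x)u − D(g_{M,0} − η)(x)u‖ ≤ |M| Bₐ |a| ‖u‖ / ‖x̲‖³` — tilting or switching off
the spin changes the Kerr–Schild form only at the orders `M|a|/d²`, `M|a|/d³`. Proof by scaling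
(`Kerr.ksPert_smul` with `ε = 1/‖x̲‖`), stationarity (`Kerr.ksPert_eq_of_spatial_eq`) and
`kerrSpin_lipschitz_unit`. [cite: KerrSchild1965, §3] -/
theorem kerrSpin_exists_lipschitz_bounds :
    ∃ Bₐ : ℝ, 0 ≤ Bₐ ∧ ∀ (M a : ℝ) (x : E4), max 1 (2 * |a|) ≤ E4.spatialNorm x →
      ‖(Kerr.bilin M a x - Minkowski.bilin) - (Kerr.bilin M 0 x - Minkowski.bilin)‖ ≤
          |M| * Bₐ * |a| / E4.spatialNorm x ^ 2 ∧
      ∀ u : E4, ‖fderiv ℝ (fun y ↦ Kerr.bilin M a y - Minkowski.bilin) x u -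
          fderiv ℝ (fun y ↦ Kerr.bilin M 0 y - Minkowski.bilin) x u‖ ≤
          |M| * Bₐ * |a| / E4.spatialNorm x ^ 3 * ‖u‖ := by
  obtain ⟨L₁, L₂, hL₁, hL₂, hL⟩ := kerrSpin_lipschitz_unit
  refine ⟨max L₁ L₂, le_max_of_le_left hL₁, fun M a x hx ↦ ?_⟩
  set s := E4.spatialNorm x with hs
  have hs1 : 1 ≤ s := (le_max_left _ _).trans hx
  have hs0 : 0 < s := one_pos.trans_le hs1
  have hsa : 2 * |a| ≤ s := (le_max_right _ _).trans hx
  set ε := s⁻¹ with hε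
  have hε0 : 0 < ε := inv_pos.mpr hs0
  -- zero the time coordinate and rescale to the unit shell
  set x' : E4 := x - x 0 • E4.basisVector 0 with hx'
  have hsp : E4.spatial x = E4.spatial x' := by
    have h0 : E4.spatial (E4.basisVector 0) = 0 := by
      ext i
      simp [E4.spatial_apply]
    rw [hx', map_sub, map_smul, h0, smul_zero, sub_zero]
  have hsx' : E4.spatialNorm x' = s := by rw [hs, E4.spatialNorm, E4.spatialNorm, hsp]
  set y : E4 := ε • x' with hy
  have hy0 : y 0 = 0 := by simp [hy, hx']
  have hy1 : E4.spatialNorm y = 1 := by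
    rw [hy, Kerr.spatialNorm_smul, abs_of_pos hε0, hsx', hε, inv_mul_cancel₀ hs0.ne']
  have ha' : |ε * a| ≤ 1 / 2 := by
    rw [abs_mul, abs_of_pos hε0, hε, inv_mul_le_iff₀ hs0]
    linarith
  have hspy : E4.spatial (ε • x) = E4.spatial y := by rw [hy, map_smul, map_smul, hsp]
  have hn : E4.spatialNorm (ε • x) = 1 := by
    rw [E4.spatialNorm, hspy]
    exact hy1
  obtain ⟨hval, hder⟩ := hL (ε * a) ha' y hy0 hy1
  have hLmax1 : L₁ ≤ max L₁ L₂ := le_max_left _ _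
  have hLmax2 : L₂ ≤ max L₁ L₂ := le_max_right _ _
  constructor
  · -- values
    have e1 : Kerr.bilin M a x - Minkowski.bilin =
        (ε * M) • (Kerr.bilin 1 (ε * a) y - Minkowski.bilin) := by
      rw [Kerr.ksPert_smul hε0 M a x, Kerr.ksPert_eq_of_spatial_eq 1 (ε * a) hspy]
    have e0 : Kerr.bilin M 0 x - Minkowski.bilin =
        (ε * M) • (Kerr.bilin 1 0 y - Minkowski.bilin) := by
      rw [Kerr.ksPert_smul hε0 M 0 x, mul_zero, Kerr.ksPert_eq_of_spatial_eq 1 0 hspy]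
    have hsub : (ε * M) • (Kerr.bilin 1 (ε * a) y - Minkowski.bilin) -
        (ε * M) • (Kerr.bilin 1 0 y - Minkowski.bilin) =
        (ε * M) • ((Kerr.bilin 1 (ε * a) y - Minkowski.bilin) - (Kerr.bilin 1 0 y - Minkowski.bilin)) :=
      (smul_sub (ε * M) (Kerr.bilin 1 (ε * a) y - Minkowski.bilin)
        (Kerr.bilin 1 0 y - Minkowski.bilin)).symm
    rw [e1, e0, hsub]
    refine (bilin_norm_smul_le _ _ hval).trans ?_
    rw [abs_mul, abs_of_pos hε0]
    have hEq : ε * |M| * (L₁ * |ε * a|) = |M| * L₁ * |a| / s ^ 2 := by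
      rw [abs_mul, abs_of_pos hε0, hε]
      field_simp
    rw [hEq]
    gcongr
  · intro u
    -- derivatives: chain rule for `z ↦ (εM) (g_{1,a'} − η)(εz)`, then stationarity
    have hD : ∀ a' : ℝ, |a'| ≤ 1 / 2 →
        fderiv ℝ (fun z : E4 ↦ (ε * M) • (Kerr.bilin 1 a' (ε • z) - Minkowski.bilin)) x u =
          (ε * M * ε) • fderiv ℝ (fun w ↦ Kerr.bilin 1 a' w - Minkowski.bilin) y u := by
      intro a' ha'1
      set F : E4 → E4 →L[ℝ] E4 →L[ℝ] ℝ := fun w ↦ Kerr.bilin 1 a' w - Minkowski.bilin with hF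
      have hrad : 0 < Kerr.radius a' (ε • x) :=
        Kerr.radius_pos_of_abs_lt (by rw [hn]; linarith)
      have hFd : HasFDerivAt F (fderiv ℝ F (ε • x)) (ε • x) :=
        ((Kerr.contDiffAt_ksPert (M := 1) hrad (n := 1)).differentiableAt one_ne_zero).hasFDerivAt
      have hsm : HasFDerivAt (fun z : E4 ↦ ε • z) (ε • ContinuousLinearMap.id ℝ E4) x :=
        (hasFDerivAt_id x).const_smul ε
      have hcomp := HasFDerivAt.comp (g := F) (f := fun z : E4 ↦ ε • z) x hFd hsm
      have hsc := hcomp.const_smul (ε * M)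
      have hsc' : HasFDerivAt (fun z : E4 ↦ (ε * M) • (Kerr.bilin 1 a' (ε • z) - Minkowski.bilin))
          ((ε * M) • ((fderiv ℝ F (ε • x)).comp (ε • ContinuousLinearMap.id ℝ E4))) x := hsc
      -- stationarity: the gradient at `εx` is the gradient at `y`
      have htr : fderiv ℝ F (ε • x) = fderiv ℝ F y := by
        have hfun : (fun w ↦ F (w + (ε • x - y))) = F := by
          funext w
          simp only [hF]
          exact Kerr.ksPert_eq_of_spatial_eq 1 a'
            (by rw [map_add, map_sub, hspy, sub_self, add_zero])
        have h := fderiv_comp_add_right (𝕜 := ℝ) (f := F) (x := y) (ε • x - y)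
        rw [hfun, add_sub_cancel] at h
        exact h.symm
      rw [hsc'.fderiv, htr]
      change (ε * M) • (fderiv ℝ F y ((ε • ContinuousLinearMap.id ℝ E4) u)) =
        (ε * M * ε) • fderiv ℝ F y u
      have hid : (ε • ContinuousLinearMap.id ℝ E4) u = ε • u := rfl
      rw [hid, map_smul, smul_smul]
    have hfa : (fun z ↦ Kerr.bilin M a z - Minkowski.bilin) =
        fun z ↦ (ε * M) • (Kerr.bilin 1 (ε * a) (ε • z) - Minkowski.bilin) :=
      funext (Kerr.ksPert_smul hε0 M a)
    have hf0 : (fun z ↦ Kerr.bilin M 0 z - Minkowski.bilin) =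
        fun z ↦ (ε * M) • (Kerr.bilin 1 0 (ε • z) - Minkowski.bilin) := by
      funext z
      have h := Kerr.ksPert_smul hε0 M 0 z
      rwa [mul_zero] at h
    have ha'0 : |(0 : ℝ)| ≤ 1 / 2 := by norm_num
    have hsub : (ε * M * ε) • fderiv ℝ (fun w ↦ Kerr.bilin 1 (ε * a) w - Minkowski.bilin) y u -
        (ε * M * ε) • fderiv ℝ (fun w ↦ Kerr.bilin 1 0 w - Minkowski.bilin) y u =
        (ε * M * ε) • (fderiv ℝ (fun w ↦ Kerr.bilin 1 (ε * a) w - Minkowski.bilin) y u -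
          fderiv ℝ (fun w ↦ Kerr.bilin 1 0 w - Minkowski.bilin) y u) :=
      (smul_sub (ε * M * ε) (fderiv ℝ (fun w ↦ Kerr.bilin 1 (ε * a) w - Minkowski.bilin) y u)
        (fderiv ℝ (fun w ↦ Kerr.bilin 1 0 w - Minkowski.bilin) y u)).symm
    rw [hfa, hf0, hD (ε * a) ha', hD 0 ha'0, hsub]
    refine (bilin_norm_smul_le _ _ (hder u)).trans ?_
    have habs : |ε * M * ε| = ε * |M| * ε := by
      rw [abs_mul, abs_mul, abs_of_pos hε0]
    rw [habs]
    have hEq : ε * |M| * ε * (L₂ * |ε * a| * ‖u‖) = |M| * L₂ * |a| / s ^ 3 * ‖u‖ := by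
      rw [abs_mul, abs_of_pos hε0, hε]
      field_simp
    rw [hEq]
    gcongr

-- the algebraic and the operator-norm instance paths on `E4 →L[ℝ] E4 →L[ℝ] ℝ` unify slowly
set_option synthInstance.maxHeartbeats 200000 in
/-- **Registered sub-goal form** (worker carrier `kerrSpin_lipschitz_bounds` of the crux item) of
`kerrSpin_exists_lipschitz_bounds`: Lipschitz dependence of the Kerr–Schild form and of its gradient
on the spin, with the sharp decay `M|a|/d²`, `M|a|/d³` (Kerr–Schild 1965, §3). [cite: KerrSchild1965, §3] -/
theorem kerrSpin_lipschitz_bounds : open Literature.Geometry.Lorentzian in ∃ Bₐ : ℝ, 0 ≤ Bₐ ∧ ∀ (M a : ℝ) (x : E4), max 1 (2 * |a|) ≤ E4.spatialNorm x → ‖(Kerr.bilin M a x - Minkowski.bilin) - (Kerr.bilin M 0 x - Minkowski.bilin)‖ ≤ |M| * Bₐ * |a| / E4.spatialNorm x ^ 2 ∧ ∀ u : E4, ‖fderiv ℝ (fun y ↦ Kerr.bilin M a y - Minkowski.bilin) x u - fderiv ℝ (fun y ↦ Kerr.bilin M 0 y - Minkowski.bilin) x u‖ ≤ |M| * Bₐ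 * |a| / E4.spatialNorm x ^ 3 * ‖u‖ :=
  kerrSpin_exists_lipschitz_bounds

end Summit.FinalStateConjecture.FinalStateConjecture.Theorems.SublinearIsFree.WeightedRates

end
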